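import Mathlib
import HarnessLib
import Summits.HodgeConjecture.HodgeConjecture.Theses.KleimanBFSeeds
import Summits.HodgeConjecture.HodgeConjecture.Theorems.Ring2AbelianAllAndreTwistedSquareEvenInhabitants
import Summits.HodgeConjecture.HodgeConjecture.Theorems.Ring2AbelianAllWeilSimilarAnchors
import Summits.HodgeConjecture.HodgeConjecture.Theorems.Ring2AbelianAllWeilSignCells
import Literature.AlgebraicGeometry.VanGeemen1994.HyperbolicOfSplitDiscriminant
import Literature.AlgebraicGeometry.HodgeTheory.WeilClassesBFSheafSeedAt

/-!
# Route `KleimanBFSeeds`: the rung `WeilSixfolds` needs K2 only at Chern characters WITH KLEIMAN'S NORMAL FORM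
# (restatement certificates for crux stmt-HodgeConjecture-25931)

HONEST FRAMING: bookkeeping HELPER for the crux K2 `KleimanSemiregularAnchor` (stmt-HodgeConjecture-25931; registered stub
`stub_good : GoodAnchorPerDiscriminantClass`, skeleton `Cruxes/KleimanSemiregularAnchor/Lines/chosen_anchor.lean`). Every
theorem here keeps ALL six binders of the route's deciding theorem as hypotheses; no binder, stub, crux, rung or summit
is proved, and nothing toward HC / HC_AV / HC_CM. What it certifies, kernel-checked: the deciding theorem
`Theses.KleimanBFSeeds.closes` uses the `∀ C` crux K2 ONLY at the Chern character `C` delivered by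
`KleimanChernCharacterOnBetti` — a `C` with `C.KleimanChernNormalForm` — so K2 may be RESTATED over such `C` without
touching the glue (refuter read-back on the item, 2026-08-28: "'∀C' could be weakened to C with KleimanChernNormalForm
(all closes uses)"; census row (v7) of the item: the unrestricted `∀ C` ranges over a hypothesis STRUCTURE whose exotic
inhabitants cannot be evaluated on a concrete sheaf):

* `kleimanSemiregularAnchorAt_of_goodAnchorPerDiscriminantClassAt` — POINTWISE in `C`: one good anchor per non-split
  discriminant class for `C` gives the K2 statement for `C` (the proof of
  `kleimanSemiregularAnchor_of_goodAnchor_in_each_discriminantClass`, p793968, which is pointwise; Landherr / van Geemen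
  5.2–5.4);
* `weilSixfolds_of_kleimanSemiregularAnchorAt_kleimanC` — the route's chain with K2 replaced by
  K2ᴷ := `∀ C, C.KleimanChernNormalForm → (K2 at C)`: `KleimanChernCharacterOnBetti → BFVariationalHodge → K2ᴷ →
  KodairaHyperplaneClass → HyperbolicFloor → SimilarReach → WeilSixfolds` (verbatim the proof of `closes`);
* `weilSixfolds_of_goodAnchorPerDiscriminantClassAt_kleimanC` — the same with the registered stub's shape restricted
  to Kleiman `C`: `∀ C, C.KleimanChernNormalForm → (GoodAnchorPerDiscriminantClass at C)` in place of K2.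
So a planner may restate item 25931 as K2ᴷ, or directly as the per-class statement over Kleiman `C`, and re-glue with
these terms; K2 ⟹ K2ᴷ trivially (`kleimanSemiregularAnchorAt_kleimanC_of_kleimanSemiregularAnchor`).

References: [vanGeemen1994HodgeAV] 4.14, Lemma 5.2, 5.3–5.4; [Landherr1936HermitianForms]; [BuchweitzFlenner2003]
§5 Thm. 5.1; [Markman2025 = arXiv:1805.11574] (floor); [Fulton1998] Example 15.3.2 (normal form).
-/

-- every declaration of this problem lives in `Summit.HodgeConjecture.HodgeConjecture.…` (summit = sub-problem)
set_option linter.dupNamespace false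

noncomputable section

open CategoryTheory AlgebraicGeometry

namespace Summit.HodgeConjecture.HodgeConjecture.Theorems

open Literature.AlgebraicGeometry Literature.AlgebraicGeometry.Motives
open Literature.AlgebraicGeometry.HodgeTheory
open Literature.AlgebraicGeometry.VanGeemen1994
open Literature.AlgebraicTopology.SingularHomology
open Summit.HodgeConjecture.HodgeConjecture.Ring2.AbelianAll
open Summit.HodgeConjecture.HodgeConjecture.Theses.KleimanBFSeeds

/-! ### §1 Pointwise in `C`: one good anchor per discriminant class ⟹ K2 at `C` -/

/-- **K2 at a fixed Chern character `C` from one good anchor per non-split discriminant class for that `C`**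
(the pointwise form of `kleimanSemiregularAnchor_of_goodAnchor_in_each_discriminantClass`): the member's class `δ` has
sign `(-1)³` and is not split; the good anchor of class `δ` is not hyperbolic at `h(e, a)` and is Weil-similar to the
member by Landherr. [cite: vanGeemen1994HodgeAV, 4.14, Lemma 5.2 (1)–(4), 5.3–5.4] [cite: Landherr1936HermitianForms] -/
theorem kleimanSemiregularAnchorAt_of_goodAnchorPerDiscriminantClassAt (C : ChernCharacterBetti)
    (hgood :
      ∀ (d : ℕ) (δ : weilNormResidueGroup d), 0 < d → weilSign d δ = (-1) ^ 3 → δ ≠ QuotientGroup.mk ((-1 : ℚˣ) ^ 3) →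
      ∃ (P : AbelianVariety ℂ) (ψ₀ : P ⟶ P) (e e' : ProjectiveEmbedding P.X)
        (a : complexBetti (projectiveSpace e.n ℂ) 2) (a' : complexBetti (projectiveSpace e'.n ℂ) 2)
        (w : complexBetti P.X (2 * 3)),
        P.dim = 2 * 3 ∧ ψ₀ ≫ ψ₀ = -(d • 𝟙 P) ∧ IsRationalClass a ∧ a ≠ 0 ∧ IsRationalClass a' ∧ a' ≠ 0 ∧
        w ∈ weilClassesOf P ψ₀ 3 d ∧ IsRationalClass w ∧ w ≠ 0 ∧ IsOfHodgeType (2 * 3) P.X (2 * 3) 3 3 w ∧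
        IsHyperbolicWeilType P ψ₀ 3
          ((d : ℂ) • complexBetti.map e'.ι 2 a' + complexBetti.map ψ₀.hom.hom.hom 2 (complexBetti.map e'.ι 2 a')) ∧
        HasWeilDiscriminantNondeg P ψ₀ 3 d
          ((d : ℂ) • complexBetti.map e.ι 2 a + complexBetti.map ψ₀.hom.hom.hom 2 (complexBetti.map e.ι 2 a)) δ ∧
        (HasWeilClassDesignAt C 3 P
            ((d : ℂ) • complexBetti.map e.ι 2 a + complexBetti.map ψ₀.hom.hom.hom 2 (complexBetti.map e.ι 2 a)) w →
          HasBFSheafSeedAt C 3 P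
            ((d : ℂ) • complexBetti.map e.ι 2 a + complexBetti.map ψ₀.hom.hom.hom 2 (complexBetti.map e.ι 2 a)) w)) :
      ∀ d : ℕ, 0 < d → ∀ (A : AbelianVariety ℂ) (φ : A ⟶ A), A.dim = 2 * 3 → φ ≫ φ = -(d • 𝟙 A) → (∀ (e :
      ProjectiveEmbedding A.X) (a : complexBetti (projectiveSpace e.n ℂ) 2), IsRationalClass a → a ≠ 0 → ¬
      IsHyperbolicWeilType A φ 3 ((d : ℂ) • complexBetti.map e.ι 2 a + complexBetti.map φ.hom.hom.hom 2
      (complexBetti.map e.ι 2 a))) → (∃ wA : complexBetti A.X (2 * 3), wA ∈ weilClassesOf A φ 3 d ∧ wA ≠ 0 ∧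
      IsOfHodgeType (2 * 3) A.X (2 * 3) 3 3 wA) → ∃ (eA : ProjectiveEmbedding A.X) (aA : complexBetti
      (projectiveSpace eA.n ℂ) 2) (P : AbelianVariety ℂ) (ψ₀ : P ⟶ P) (e e' : ProjectiveEmbedding P.X) (a :
      complexBetti (projectiveSpace e.n ℂ) 2) (a' : complexBetti (projectiveSpace e'.n ℂ) 2) (w : complexBetti
      P.X (2 * 3)), IsRationalClass aA ∧ aA ≠ 0 ∧ P.dim = 2 * 3 ∧ ψ₀ ≫ ψ₀ = -(d • 𝟙 P) ∧ IsRationalClass a ∧ a ≠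
      0 ∧ IsRationalClass a' ∧ a' ≠ 0 ∧ w ∈ weilClassesOf P ψ₀ 3 d ∧ IsRationalClass w ∧ w ≠ 0 ∧ IsOfHodgeType
      (2 * 3) P.X (2 * 3) 3 3 w ∧ IsHyperbolicWeilType P ψ₀ 3 ((d : ℂ) • complexBetti.map e'.ι 2 a' +
      complexBetti.map ψ₀.hom.hom.hom 2 (complexBetti.map e'.ι 2 a')) ∧ ¬ IsHyperbolicWeilType P ψ₀ 3 ((d : ℂ) •
      complexBetti.map e.ι 2 a + complexBetti.map ψ₀.hom.hom.hom 2 (complexBetti.map e.ι 2 a)) ∧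
      (HasWeilClassDesignAt C 3 P ((d : ℂ) • complexBetti.map e.ι 2 a + complexBetti.map ψ₀.hom.hom.hom 2
      (complexBetti.map e.ι 2 a)) w → HasBFSheafSeedAt C 3 P ((d : ℂ) • complexBetti.map e.ι 2 a +
      complexBetti.map ψ₀.hom.hom.hom 2 (complexBetti.map e.ι 2 a)) w) ∧ IsWeilSimilar 3 P ψ₀ ((d : ℂ) •
      complexBetti.map e.ι 2 a + complexBetti.map ψ₀.hom.hom.hom 2 (complexBetti.map e.ι 2 a)) A φ ((d : ℂ) •
      complexBetti.map eA.ι 2 aA + complexBetti.map φ.hom.hom.hom 2 (complexBetti.map eA.ι 2 aA)) := by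
  intro d hd A φ hA hφ hns hwA
  obtain ⟨wA, hwA, hwA0, hwAH⟩ := hwA
  have n3 : (0 : ℕ) < 3 := by norm_num
  have hW' : IsWeilType A φ 3 d := isWeilType_of_weilClass_ne_zero n3 hd hA hφ hwA hwA0 hwAH
  obtain ⟨eA, aA, haA, haA0, -⟩ := exists_weightedSegreEmbedding_self_prod A
  obtain ⟨δ, hδA, hsign⟩ := exists_hasWeilDiscriminantNondeg_weilSign hW' eA haA haA0
  have hne : δ ≠ QuotientGroup.mk ((-1 : ℚˣ) ^ 3) := by
    rintro rfl
    obtain ⟨-, e, a, ha, ha0, hh⟩ :=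
      Literature.AlgebraicGeometry.VanGeemen1994.IsWeilType.isSplitWeilType_of_hasWeilDiscriminantNondeg_split
        hW' eA haA haA0 hδA
    exact hns e a ha ha0 hh
  obtain ⟨P, ψ₀, e, e', a, a', w, hP, hψ, ha, ha0, ha', ha'0, hwW, hwrat, hw0, hwH, hhyp, hN, hup⟩ :=
    hgood d δ hd hsign hne
  have hWP : IsWeilType P ψ₀ 3 d := isWeilType_of_weilClass_ne_zero n3 hd hP hψ hwW hw0 hwH
  have hnot := not_isHyperbolicWeilType_of_hasWeilDiscriminantNondeg_ne n3 hP hd hψ e ha ha0 hN hne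
  have hsim := isWeilSimilar_of_hasWeilDiscriminantNondeg hWP hW' e ha ha0 eA haA haA0 hN hδA
  exact ⟨eA, aA, P, ψ₀, e, e', a, a', w, haA, haA0, hP, hψ, ha, ha0, ha', ha'0, hwW, hwrat, hw0, hwH, hhyp,
    hnot, hup, hsim⟩

/-! ### §2 The rung from K2 restricted to Kleiman `C` -/

/-- **K2 ⟹ K2ᴷ** (the restriction to Chern characters with Kleiman's normal form is implied by the route's `∀ C` crux).
[cite: Fulton1998, Example 15.3.2] -/
theorem kleimanSemiregularAnchorAt_kleimanC_of_kleimanSemiregularAnchor (k2 : KleimanSemiregularAnchor)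
    (C : ChernCharacterBetti) (_hC : C.KleimanChernNormalForm) :
      ∀ d : ℕ, 0 < d → ∀ (A : AbelianVariety ℂ) (φ : A ⟶ A), A.dim = 2 * 3 → φ ≫ φ = -(d • 𝟙 A) → (∀ (e :
      ProjectiveEmbedding A.X) (a : complexBetti (projectiveSpace e.n ℂ) 2), IsRationalClass a → a ≠ 0 → ¬
      IsHyperbolicWeilType A φ 3 ((d : ℂ) • complexBetti.map e.ι 2 a + complexBetti.map φ.hom.hom.hom 2
      (complexBetti.map e.ι 2 a))) → (∃ wA : complexBetti A.X (2 * 3), wA ∈ weilClassesOf A φ 3 d ∧ wA ≠ 0 ∧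
      IsOfHodgeType (2 * 3) A.X (2 * 3) 3 3 wA) → ∃ (eA : ProjectiveEmbedding A.X) (aA : complexBetti
      (projectiveSpace eA.n ℂ) 2) (P : AbelianVariety ℂ) (ψ₀ : P ⟶ P) (e e' : ProjectiveEmbedding P.X) (a :
      complexBetti (projectiveSpace e.n ℂ) 2) (a' : complexBetti (projectiveSpace e'.n ℂ) 2) (w : complexBetti
      P.X (2 * 3)), IsRationalClass aA ∧ aA ≠ 0 ∧ P.dim = 2 * 3 ∧ ψ₀ ≫ ψ₀ = -(d • 𝟙 P) ∧ IsRationalClass a ∧ a ≠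
      0 ∧ IsRationalClass a' ∧ a' ≠ 0 ∧ w ∈ weilClassesOf P ψ₀ 3 d ∧ IsRationalClass w ∧ w ≠ 0 ∧ IsOfHodgeType
      (2 * 3) P.X (2 * 3) 3 3 w ∧ IsHyperbolicWeilType P ψ₀ 3 ((d : ℂ) • complexBetti.map e'.ι 2 a' +
      complexBetti.map ψ₀.hom.hom.hom 2 (complexBetti.map e'.ι 2 a')) ∧ ¬ IsHyperbolicWeilType P ψ₀ 3 ((d : ℂ) •
      complexBetti.map e.ι 2 a + complexBetti.map ψ₀.hom.hom.hom 2 (complexBetti.map e.ι 2 a)) ∧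
      (HasWeilClassDesignAt C 3 P ((d : ℂ) • complexBetti.map e.ι 2 a + complexBetti.map ψ₀.hom.hom.hom 2
      (complexBetti.map e.ι 2 a)) w → HasBFSheafSeedAt C 3 P ((d : ℂ) • complexBetti.map e.ι 2 a +
      complexBetti.map ψ₀.hom.hom.hom 2 (complexBetti.map e.ι 2 a)) w) ∧ IsWeilSimilar 3 P ψ₀ ((d : ℂ) •
      complexBetti.map e.ι 2 a + complexBetti.map ψ₀.hom.hom.hom 2 (complexBetti.map e.ι 2 a)) A φ ((d : ℂ) •
      complexBetti.map eA.ι 2 aA + complexBetti.map φ.hom.hom.hom 2 (complexBetti.map eA.ι 2 aA)) :=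
  k2 C

/-- **`WeilSixfolds` from the route's binders with K2 RESTRICTED to Kleiman `C`** (K2ᴷ): verbatim the proof of the
deciding theorem `Theses.KleimanBFSeeds.closes`, which applies K2 only to the `C` (with `C.KleimanChernNormalForm`)
produced by `KleimanChernCharacterOnBetti`; Markman's floor makes `w` algebraic at the hyperbolic `h′`, Kleiman's normal
form + Kodaira give the class design (`KleimanChernNormalForm.hasWeilClassDesignAt_smul_add_map`), the upgrade gives the
seed, Buchweitz–Flenner's door the local clause, and the ladder theorem the rung.
[cite: BuchweitzFlenner2003, §5 Thm. 5.1] [cite: vanGeemen1994HodgeAV, Lemma 5.2 and 5.3–5.4] -/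
theorem weilSixfolds_of_kleimanSemiregularAnchorAt_kleimanC (hKC : KleimanChernCharacterOnBetti)
    (hBF : BFVariationalHodge)
    (k2K : ∀ C : ChernCharacterBetti, C.KleimanChernNormalForm →
      ∀ d : ℕ, 0 < d → ∀ (A : AbelianVariety ℂ) (φ : A ⟶ A), A.dim = 2 * 3 → φ ≫ φ = -(d • 𝟙 A) → (∀ (e :
      ProjectiveEmbedding A.X) (a : complexBetti (projectiveSpace e.n ℂ) 2), IsRationalClass a → a ≠ 0 → ¬
      IsHyperbolicWeilType A φ 3 ((d : ℂ) • complexBetti.map e.ι 2 a + complexBetti.map φ.hom.hom.hom 2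
      (complexBetti.map e.ι 2 a))) → (∃ wA : complexBetti A.X (2 * 3), wA ∈ weilClassesOf A φ 3 d ∧ wA ≠ 0 ∧
      IsOfHodgeType (2 * 3) A.X (2 * 3) 3 3 wA) → ∃ (eA : ProjectiveEmbedding A.X) (aA : complexBetti
      (projectiveSpace eA.n ℂ) 2) (P : AbelianVariety ℂ) (ψ₀ : P ⟶ P) (e e' : ProjectiveEmbedding P.X) (a :
      complexBetti (projectiveSpace e.n ℂ) 2) (a' : complexBetti (projectiveSpace e'.n ℂ) 2) (w : complexBetti
      P.X (2 * 3)), IsRationalClass aA ∧ aA ≠ 0 ∧ P.dim = 2 * 3 ∧ ψ₀ ≫ ψ₀ = -(d • 𝟙 P) ∧ IsRationalClass a ∧ a ≠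
      0 ∧ IsRationalClass a' ∧ a' ≠ 0 ∧ w ∈ weilClassesOf P ψ₀ 3 d ∧ IsRationalClass w ∧ w ≠ 0 ∧ IsOfHodgeType
      (2 * 3) P.X (2 * 3) 3 3 w ∧ IsHyperbolicWeilType P ψ₀ 3 ((d : ℂ) • complexBetti.map e'.ι 2 a' +
      complexBetti.map ψ₀.hom.hom.hom 2 (complexBetti.map e'.ι 2 a')) ∧ ¬ IsHyperbolicWeilType P ψ₀ 3 ((d : ℂ) •
      complexBetti.map e.ι 2 a + complexBetti.map ψ₀.hom.hom.hom 2 (complexBetti.map e.ι 2 a)) ∧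
      (HasWeilClassDesignAt C 3 P ((d : ℂ) • complexBetti.map e.ι 2 a + complexBetti.map ψ₀.hom.hom.hom 2
      (complexBetti.map e.ι 2 a)) w → HasBFSheafSeedAt C 3 P ((d : ℂ) • complexBetti.map e.ι 2 a +
      complexBetti.map ψ₀.hom.hom.hom 2 (complexBetti.map e.ι 2 a)) w) ∧ IsWeilSimilar 3 P ψ₀ ((d : ℂ) •
      complexBetti.map e.ι 2 a + complexBetti.map ψ₀.hom.hom.hom 2 (complexBetti.map e.ι 2 a)) A φ ((d : ℂ) •
      complexBetti.map eA.ι 2 aA + complexBetti.map φ.hom.hom.hom 2 (complexBetti.map eA.ι 2 aA)))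
    (hK : KodairaHyperplaneClass) (h₃ : HyperbolicFloor) (h₄ : SimilarReach) :
    Summit.HodgeConjecture.HodgeConjecture.Theses.SevenfoldWeilCensus.WeilSixfolds := by
  obtain ⟨C, hCK⟩ := hKC
  exact Summit.HodgeConjecture.HodgeConjecture.WeilTypeLadder.weilSixfolds_of_floor_of_reachSimilar_of_similarAnchorsAwayFromSplit
    h₃ h₄ (fun d hd A φ hA hφ hnh hwA => by
      obtain ⟨eA, aA, P, ψ₀, e, e', a, a', w, haA, haA0, hP, hψ, ha, ha0, ha', ha'0, hwW, hwrat, hw0, hwH, hhyp,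
        hnhyp, himp, hsim⟩ :=
        k2K C hCK d hd A φ hA hφ hnh hwA
      have hsp : IsSmoothProjective (2 * 3) P.X := hP ▸ AbelianVariety.isSmoothProjective_holds (A := P)
      have hwalg : w ∈ algebraicClasses P.X 3 := h₃ d hd P ψ₀ hP hsp hψ e' a' ha' ha'0 hhyp w hwrat hwH hwW
      have hPpos : 0 < P.dim := by rw [hP]; norm_num
      have hdesign : HasWeilClassDesignAt C 3 P
          ((d : ℂ) • complexBetti.map e.ι 2 a + complexBetti.map ψ₀.hom.hom.hom 2 (complexBetti.map e.ι 2 a)) w :=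
        hCK.hasWeilClassDesignAt_smul_add_map hK P hPpos ψ₀ e ha ha0 hd (by norm_num) hwrat hwalg
      exact ⟨eA, aA, P, ψ₀, e, a, w, haA, haA0, hP, hψ, ha, ha0, hwW, hwrat, hw0, hwH,
        weilAnchorLocalClause_of_BF_of_hasBFSheafSeedAt hBF C (by norm_num) d P _ w (himp hdesign), hsim⟩)

/-- **`WeilSixfolds` from the route's binders with the registered stub's shape restricted to Kleiman `C`**: one good
anchor per non-split discriminant class for every `C` with Kleiman's normal form suffices (§1 pointwise + §2).
[cite: vanGeemen1994HodgeAV, Lemma 5.2 and 5.3–5.4] [cite: BuchweitzFlenner2003, §5 Thm. 5.1] -/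
theorem weilSixfolds_of_goodAnchorPerDiscriminantClassAt_kleimanC (hKC : KleimanChernCharacterOnBetti)
    (hBF : BFVariationalHodge)
    (hgoodK : ∀ C : ChernCharacterBetti, C.KleimanChernNormalForm →
      ∀ (d : ℕ) (δ : weilNormResidueGroup d), 0 < d → weilSign d δ = (-1) ^ 3 → δ ≠ QuotientGroup.mk ((-1 : ℚˣ) ^ 3) →
      ∃ (P : AbelianVariety ℂ) (ψ₀ : P ⟶ P) (e e' : ProjectiveEmbedding P.X)
        (a : complexBetti (projectiveSpace e.n ℂ) 2) (a' : complexBetti (projectiveSpace e'.n ℂ) 2)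
        (w : complexBetti P.X (2 * 3)),
        P.dim = 2 * 3 ∧ ψ₀ ≫ ψ₀ = -(d • 𝟙 P) ∧ IsRationalClass a ∧ a ≠ 0 ∧ IsRationalClass a' ∧ a' ≠ 0 ∧
        w ∈ weilClassesOf P ψ₀ 3 d ∧ IsRationalClass w ∧ w ≠ 0 ∧ IsOfHodgeType (2 * 3) P.X (2 * 3) 3 3 w ∧
        IsHyperbolicWeilType P ψ₀ 3
          ((d : ℂ) • complexBetti.map e'.ι 2 a' + complexBetti.map ψ₀.hom.hom.hom 2 (complexBetti.map e'.ι 2 a')) ∧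
        HasWeilDiscriminantNondeg P ψ₀ 3 d
          ((d : ℂ) • complexBetti.map e.ι 2 a + complexBetti.map ψ₀.hom.hom.hom 2 (complexBetti.map e.ι 2 a)) δ ∧
        (HasWeilClassDesignAt C 3 P
            ((d : ℂ) • complexBetti.map e.ι 2 a + complexBetti.map ψ₀.hom.hom.hom 2 (complexBetti.map e.ι 2 a)) w →
          HasBFSheafSeedAt C 3 P
            ((d : ℂ) • complexBetti.map e.ι 2 a + complexBetti.map ψ₀.hom.hom.hom 2 (complexBetti.map e.ι 2 a)) w))
    (hK : KodairaHyperplaneClass) (h₃ : HyperbolicFloor) (h₄ : SimilarReach) :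
    Summit.HodgeConjecture.HodgeConjecture.Theses.SevenfoldWeilCensus.WeilSixfolds :=
  weilSixfolds_of_kleimanSemiregularAnchorAt_kleimanC hKC hBF
    (fun C hC => kleimanSemiregularAnchorAt_of_goodAnchorPerDiscriminantClassAt C (hgoodK C hC)) hK h₃ h₄

end Summit.HodgeConjecture.HodgeConjecture.Theorems

end
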